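import Summits.HodgeConjecture.HodgeConjecture.Theorems.R90S6ShellSphereDictU2       -- ★ A1-H FILE 1 (p01): `isUnimodular₂_antidiagonal_two`, `valuation_map_eq_of_datum`; brings ★ `HermitianLatticeTree*` (frames `exists_frame ∕ isSelfDualLattice_frame_iff ∕ isModularLattice_frame_iff`, (D1)∕(D2), `isTree_latticeTree`, `latticeTreeIso_apply_eq_self_iff`), the `Valued`∕`ValuativeRel` bridge
import HarnessLib

/-!
# R90 · S6 — CARD HF1 (row E1.3.5.2.6, H side), FILE A1: NORMAL FRAMES ON `X₂` — every vertex is the end of a framed geodesic from the root, and its distance from the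
# root is the level of the frame (`Theorems/R90S6TreeNormalFrameU2.lean`)

Cell `hodgecm-mathlib`, crux H413 (`stmt-HodgeConjecture-24833`), route of record `HCCMUnconditional`; programme R90-TF, section S6 (base `R90-C14`), seat
R90-C14-p03 (g3); card HF1 «Fix AND FIRST SHELLS ON `X₂` FOR THE UNRAMIFIED-`E¹` COMPRESSIONS» (dealer R90-C14-plan (g2), R90 bus 2026-09-05T02:15:20Z).  Helper lane
`--supports stmt-HodgeConjecture-24833 --as helper`; THEOREMS ONLY (no definition, no instance, no notation, no named fact, no `sorry`).

SETTING (★ A1-H ∕ ★ H2 letters).  `K : Type` with `Valued K ℤᵐ⁰` and `ValuativeRel K` compatible, the cell's unramified datum `hd : UnramifiedLocalConjDatum σ ϖ`,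
`J₂ = (StdForm.antidiagonal 2).over K = !![0,1;1,0]`, `U₂ = unitaryGroupOfForm σ J₂`, `X₂ = latticeTree σ ϖ J₂` the ★ tree of self-dual and `ϖ`-modular lattices (★
`isTree_latticeTree`), root `x₀` with `x₀.1 = latt 1 = 𝒪²`, `U₂` acting by ★ `latticeTreeIso`; Gram matrix of a frame `G = formCongr σ P J₂ = (σP)ᵀ J₂ P`.

THE MATHEMATICS (Serre, *Trees*, II.1.1; Bruhat–Tits §10).  The tree distance from the root, read on LATTICES:
* §1 **framed geodesics**: for `P ∈ GL₂(𝒪)` with `|G₀₀| ≤ |ϖ|^N`, the chain `A_m = latt (P·diag(ϖ^{−⌊m∕2⌋}, ϖ^{⌈m∕2⌉}))`, `m ≤ N`, consists of special lattices (self-dual for even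
  `m`, `ϖ`-modular for odd `m` — ★ frame criteria: the only non-trivial entry bound is `|ϖ|^{−m}|G₀₀| ≤ 1`), consecutive ones adjacent and pairwise distinct (★ frame calculus
  `scaleLattice_uniformizer_latt_mul_diagonal ∕ latt_mul_diagonal_le_iff`), hence **`d(x₀, A_m) = m`** (§0 `dist_eq_of_adj_chain_of_le`, the bounded edition of ★ A1-H `dist_eq_of_adj_chain`);
* §2 **normal frames**: EVERY vertex is `A_N` for some `P ∈ GL₂(𝒪)` and `N` with `|G₀₀| ≤ |ϖ|^N` (★ `exists_frame`, a column swap to order the exponents, and the frame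
  criteria `a + b ∈ {0,1}`, `|ϖ|^{2a − [modular]}|G₀₀| ≤ 1`; `N = b − a = 2·depth − [modular]`) — so `d(x₀, v)` is the LEVEL `N` of any normal frame of `v`;
* §3 two bookkeeping letters for the consumers (FILE A2 ∕ A3): `γ·v = v ↔ γ·v.1 ≤ v.1` for `γ ∈ U₂` ((D1)∕(D2): comparable special lattices of one type are equal), and the
  `(0,0)` Gram entry `G₀₀ = σ(x)y + σ(y)x` of a frame with first column `(x, y)`.
HONEST LABEL: lattice bookkeeping over ★ carriers; proves no printed statement, discharges no citation; count-neutral helper for HF1 ∕ (E1).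
HC_CM is proved only modulo the 7 printed citations (2 remaining named inputs: hLiu418 = stmt-HodgeConjecture-24832, h413 = stmt-HodgeConjecture-24833) until rung 0 closes; REL ≠ ★ ≠ BUILT.

## References
* [Serre1980Trees] J.-P. Serre, *Trees* (1980): I.6.4, II.1.1 (lattices, the tree of a rank-one group, distance from the base lattice).
* [BruhatTits1972] F. Bruhat, J. Tits, *Groupes réductifs sur un corps local I*, Publ. Math. IHÉS 41 (1972): §10.
* [Jacobowitz1962] R. Jacobowitz, *Hermitian forms over local fields*, Amer. J. Math. 84 (1962): §4, §7–§8 (unimodular and `𝔭`-modular hermitian lattices).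
* [Kottwitz1986BaseChangeUnits] R. E. Kottwitz, *Base change for unit elements of Hecke algebras*, Compositio Math. 60 (1986): §3 (fixed lattices).
-/

set_option autoImplicit false
-- the mandated namespace repeats the single-problem summit's segment (`HodgeConjecture.HodgeConjecture`)
set_option linter.dupNamespace false

noncomputable section

open Set Function
open scoped ValuativeRel Matrix MatrixGroups
open SimpleGraph Matrix ValuativeRel
open Literature.NumberTheory.Automorphic
open Literature.NumberTheory.Automorphic.HermitianLatticeTree
open Literature.Combinatorics.SimpleGraph

namespace Summit.HodgeConjecture.HodgeConjecture.R90.S6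

section Chain

variable {V : Type*} {G : SimpleGraph V}

/-! ## §0 Bounded geodesic chains -/

/-- **A bounded chain of adjacent vertices, injective on `[0, N]`, realises the distances in a tree**: `d(A 0, A m) = m` for `m ≤ N` (the chain is a path, and paths in
trees are geodesics, ★ `TreeDisplacement.dist_eq_length_of_isPath`; bounded edition of ★ A1-H `dist_eq_of_adj_chain`). [cite: Serre1980Trees, I.6.4, II.1.1] [cite: Diestel2010, Thm. 1.5.1] -/
theorem dist_eq_of_adj_chain_of_le (hT : G.IsTree) (N : ℕ) (A : ℕ → V) (hadj : ∀ m, m < N → G.Adj (A m) (A (m + 1)))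
    (hinj : ∀ m, m ≤ N → ∀ m', m' ≤ N → A m = A m' → m = m') {m : ℕ} (hm : m ≤ N) : G.dist (A 0) (A m) = m := by
  -- a path of length `m` from `A 0` to `A m` supported on `A 0, …, A m`
  have key : ∀ m, m ≤ N → ∃ p : G.Walk (A 0) (A m), p.IsPath ∧ p.length = m ∧ ∀ v ∈ p.support, ∃ j, j ≤ m ∧ A j = v := by
    intro m
    induction m with
    | zero =>
      intro _
      refine ⟨SimpleGraph.Walk.nil, SimpleGraph.Walk.IsPath.nil, rfl, fun v hv => ⟨0, le_rfl, ?_⟩⟩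
      rw [SimpleGraph.Walk.support_nil, List.mem_singleton] at hv
      exact hv.symm
    | succ m ih =>
      intro hmN
      obtain ⟨p, hp, hlen, hsupp⟩ := ih (by omega)
      have hnot : A (m + 1) ∉ p.support := by
        intro hmem
        obtain ⟨j, hj, hAj⟩ := hsupp _ hmem
        have := hinj j (by omega) (m + 1) hmN hAj
        omega
      refine ⟨p.concat (hadj m (by omega)), hp.concat hnot (hadj m (by omega)), by rw [SimpleGraph.Walk.length_concat, hlen], fun v hv => ?_⟩
      rw [SimpleGraph.Walk.support_concat, List.mem_append, List.mem_singleton] at hv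
      rcases hv with hv | hv
      · obtain ⟨j, hj, hAj⟩ := hsupp v hv
        exact ⟨j, by omega, hAj⟩
      · exact ⟨m + 1, le_rfl, hv.symm⟩
  obtain ⟨p, hp, hlen, -⟩ := key m hm
  rw [TreeDisplacement.dist_eq_length_of_isPath hT hp, hlen]

end Chain

section Two

variable {K : Type} [Field K] [Valued K (WithZero (Multiplicative ℤ))] [ValuativeRel K]
  [(Valued.v : Valuation K (WithZero (Multiplicative ℤ))).Compatible] {σ : K →+* K} {ϖ : K}

/-! ## §1 Framed geodesics from the root: `A_m = latt (P·diag(ϖ^{−⌊m∕2⌋}, ϖ^{⌈m∕2⌉}))` -/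

/-- **Speciality along a framed chain**: for `P ∈ GL₂(𝒪)` with `|((σP)ᵀ J₂ P)₀₀| ≤ |ϖ|^N` and `m ≤ N`, the lattice `latt (P·diag(ϖ^{−⌊m∕2⌋}, ϖ^{⌈m∕2⌉}))` is self-dual when
`m` is even and `ϖ`-modular when `m` is odd (★ `isSelfDualLattice_frame_iff ∕ isModularLattice_frame_iff`: the only non-trivial entry bound is `|ϖ|^{−m}|G₀₀| ≤ 1`).
[cite: Jacobowitz1962, §7–§8] [cite: Serre1980Trees, II.1.1] -/
theorem isSpecialLattice_latt_frame_chain (hd : HermitianLattice.UnramifiedLocalConjDatum σ ϖ) (P : GL (Fin 2) K) (hP : P ∈ glInt 2 K) (N : ℕ)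
    (hG : valuation K (formCongr σ P ((StdForm.antidiagonal 2).over K) 0 0) ≤ valuation K ϖ ^ N) {m : ℕ} (hm : m ≤ N) :
    (Even m → IsSelfDualLattice σ ((StdForm.antidiagonal 2).over K)
        (latt ((P : Matrix (Fin 2) (Fin 2) K) * Matrix.diagonal ![ϖ ^ (-((m / 2 : ℕ) : ℤ)), ϖ ^ (((m + 1) / 2 : ℕ) : ℤ)]))) ∧
    (¬ Even m → IsModularLattice σ ϖ ((StdForm.antidiagonal 2).over K)
        (latt ((P : Matrix (Fin 2) (Fin 2) K) * Matrix.diagonal ![ϖ ^ (-((m / 2 : ℕ) : ℤ)), ϖ ^ (((m + 1) / 2 : ℕ) : ℤ)]))) := by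
  have hσv := valuation_map_eq_of_datum hd
  have hϖ := isUniformizingElement_of_v_eq hd.vϖ
  have hH := isUnimodular₂_antidiagonal_two (K := K)
  have hv0 : valuation K ϖ ≠ 0 := (Valuation.ne_zero_iff _).2 hϖ.ne_zero
  have hle1 : ∀ i j, valuation K (formCongr σ P ((StdForm.antidiagonal 2).over K) i j) ≤ 1 := fun i j =>
    (Valuation.mem_integer_iff _ _).1 ((isUnimodular₂_formCongr_of_mem_glInt σ hσv hH P hP).1 i j)
  -- the (0,0) bound at exponent `−N`
  have hN : valuation K ϖ ^ (-(N : ℤ)) * valuation K (formCongr σ P ((StdForm.antidiagonal 2).over K) 0 0) ≤ 1 := by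
    calc valuation K ϖ ^ (-(N : ℤ)) * valuation K (formCongr σ P ((StdForm.antidiagonal 2).over K) 0 0)
        ≤ valuation K ϖ ^ (-(N : ℤ)) * valuation K ϖ ^ (N : ℤ) := mul_le_mul_right (by rwa [zpow_natCast]) _
      _ = 1 := by rw [← zpow_add₀ hv0, neg_add_cancel, zpow_zero]
  constructor
  · intro heven
    obtain ⟨k, hk⟩ := heven
    rw [isSelfDualLattice_frame_iff σ hσv hϖ hH P hP]
    refine ⟨by omega, fun i j => ?_⟩
    fin_cases i <;> fin_cases j <;>
      simp only [Fin.zero_eta, Fin.mk_one, Fin.isValue, Matrix.cons_val_zero, Matrix.cons_val_one]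
    · exact zpow_mul_le_one_of_le hϖ (Or.inl hN) (Or.inl (by omega))
    · exact zpow_mul_le_one_of_le hϖ (m := 0) (Or.inr ⟨hle1 0 1, by omega⟩) (Or.inr ⟨hle1 0 1, by omega⟩)
    · exact zpow_mul_le_one_of_le hϖ (m := 0) (Or.inr ⟨hle1 1 0, by omega⟩) (Or.inr ⟨hle1 1 0, by omega⟩)
    · exact zpow_mul_le_one_of_le hϖ (m := 0) (Or.inr ⟨hle1 1 1, by omega⟩) (Or.inr ⟨hle1 1 1, by omega⟩)
  · intro hodd
    rw [Nat.not_even_iff_odd] at hodd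
    obtain ⟨k, hk⟩ := hodd
    rw [isModularLattice_frame_iff σ hσv hϖ hH P hP]
    refine ⟨by omega, fun i j => ?_⟩
    fin_cases i <;> fin_cases j <;>
      simp only [Fin.zero_eta, Fin.mk_one, Fin.isValue, Matrix.cons_val_zero, Matrix.cons_val_one]
    · exact zpow_mul_le_one_of_le hϖ (Or.inl hN) (Or.inl (by omega))
    · exact zpow_mul_le_one_of_le hϖ (m := 0) (Or.inr ⟨hle1 0 1, by omega⟩) (Or.inr ⟨hle1 0 1, by omega⟩)
    · exact zpow_mul_le_one_of_le hϖ (m := 0) (Or.inr ⟨hle1 1 0, by omega⟩) (Or.inr ⟨hle1 1 0, by omega⟩)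
    · exact zpow_mul_le_one_of_le hϖ (m := 0) (Or.inr ⟨hle1 1 1, by omega⟩) (Or.inr ⟨hle1 1 1, by omega⟩)

/-- **Distance from the root along a framed chain**: for `P ∈ GL₂(𝒪)` with `|G₀₀| ≤ |ϖ|^N` and `m ≤ N`, the vertex `latt (P·diag(ϖ^{−⌊m∕2⌋}, ϖ^{⌈m∕2⌉}))` is at distance
`m` from the root `x₀ = 𝒪² = latt (P·diag(1,1))`: consecutive lattices of the chain are adjacent (★ frame calculus `scaleLattice_uniformizer_latt_mul_diagonal`,
`latt_mul_diagonal_le_iff`) and pairwise distinct, so the chain is a geodesic (§0 `dist_eq_of_adj_chain_of_le` on ★ `isTree_latticeTree`).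
[cite: Serre1980Trees, I.6.4, II.1.1] -/
theorem dist_root_eq_of_latt_frame_chain (hd : HermitianLattice.UnramifiedLocalConjDatum σ ϖ)
    (x₀ : {M : Submodule 𝒪[K] (Fin 2 → K) // IsSpecialLattice σ ϖ ((StdForm.antidiagonal 2).over K) M})
    (hx₀ : x₀.1 = latt (1 : Matrix (Fin 2) (Fin 2) K)) (P : GL (Fin 2) K) (hP : P ∈ glInt 2 K) (N : ℕ)
    (hG : valuation K (formCongr σ P ((StdForm.antidiagonal 2).over K) 0 0) ≤ valuation K ϖ ^ N)
    (v : {M : Submodule 𝒪[K] (Fin 2 → K) // IsSpecialLattice σ ϖ ((StdForm.antidiagonal 2).over K) M}) {m : ℕ} (hm : m ≤ N)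
    (hv : v.1 = latt ((P : Matrix (Fin 2) (Fin 2) K) * Matrix.diagonal ![ϖ ^ (-((m / 2 : ℕ) : ℤ)), ϖ ^ (((m + 1) / 2 : ℕ) : ℤ)])) :
    (latticeTree σ ϖ ((StdForm.antidiagonal 2).over K)).dist x₀ v = m := by
  classical
  have hσv := valuation_map_eq_of_datum hd
  have hϖ := isUniformizingElement_of_v_eq hd.vϖ
  have hH := isUnimodular₂_antidiagonal_two (K := K)
  haveI := isDiscreteValuationRing_integer_of_compatible hd.vϖ
  have hT := isTree_latticeTree σ hσv hϖ hH
  -- the chain and its speciality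
  have hsp : ∀ k, k ≤ N → IsSpecialLattice σ ϖ ((StdForm.antidiagonal 2).over K)
      (latt ((P : Matrix (Fin 2) (Fin 2) K) * Matrix.diagonal ![ϖ ^ (-((k / 2 : ℕ) : ℤ)), ϖ ^ (((k + 1) / 2 : ℕ) : ℤ)])) := by
    intro k hk
    by_cases he : Even k
    · exact Or.inl ((isSpecialLattice_latt_frame_chain hd P hP N hG hk).1 he)
    · exact Or.inr ((isSpecialLattice_latt_frame_chain hd P hP N hG hk).2 he)
  let A : ℕ → {M : Submodule 𝒪[K] (Fin 2 → K) // IsSpecialLattice σ ϖ ((StdForm.antidiagonal 2).over K) M} := fun k =>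
    if hk : k ≤ N then ⟨latt ((P : Matrix (Fin 2) (Fin 2) K) * Matrix.diagonal ![ϖ ^ (-((k / 2 : ℕ) : ℤ)), ϖ ^ (((k + 1) / 2 : ℕ) : ℤ)]), hsp k hk⟩ else x₀
  have hA : ∀ k, k ≤ N → (A k).1 = latt ((P : Matrix (Fin 2) (Fin 2) K) * Matrix.diagonal ![ϖ ^ (-((k / 2 : ℕ) : ℤ)), ϖ ^ (((k + 1) / 2 : ℕ) : ℤ)]) :=
    fun k hk => by simp only [A, dif_pos hk]
  -- injectivity on `[0, N]`
  have hinj : ∀ k, k ≤ N → ∀ k', k' ≤ N → A k = A k' → k = k' := by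
    intro k hk k' hk' hkk
    have h := congrArg Subtype.val hkk
    rw [hA k hk, hA k' hk'] at h
    have h1 := (latt_mul_diagonal_le_iff hϖ P _ _ _ _).1 h.le
    have h2 := (latt_mul_diagonal_le_iff hϖ P _ _ _ _).1 h.ge
    omega
  -- endpoints
  have h0 : A 0 = x₀ := by
    apply Subtype.ext
    rw [hA 0 (Nat.zero_le N), hx₀, latt_one_eq_latt_mul_diagonal_zero (ϖ := ϖ) P hP]
    norm_num
  have hmv : A m = v := Subtype.ext (by rw [hA m hm, hv])
  rw [← h0, ← hmv]
  refine dist_eq_of_adj_chain_of_le hT N A (fun k hk => ?_) hinj hm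
  -- adjacency of consecutive vertices
  have hne : A k ≠ A (k + 1) := fun h => by have := hinj k hk.le (k + 1) hk h; omega
  rw [latticeTree_adj_iff]
  refine ⟨hne, ?_⟩
  rcases Nat.even_or_odd k with ⟨j, hj⟩ | ⟨j, hj⟩
  · -- `A k` self-dual `(−j, j)`, `A (k+1)` modular `(−j, j+1)`
    have hsd : IsSelfDualLattice σ ((StdForm.antidiagonal 2).over K) (A k).1 := by
      rw [hA k hk.le]; exact (isSpecialLattice_latt_frame_chain hd P hP N hG hk.le).1 ⟨j, hj⟩
    have hmod : IsModularLattice σ ϖ ((StdForm.antidiagonal 2).over K) (A (k + 1)).1 := by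
      rw [hA (k + 1) hk]; exact (isSpecialLattice_latt_frame_chain hd P hP N hG (Nat.succ_le_of_lt hk)).2 (by rw [Nat.even_add_one]; exact not_not.2 ⟨j, hj⟩)
    refine Or.inl ⟨hsd, hmod, ?_, ?_⟩
    · rw [hA k hk.le, hA (k + 1) hk, scaleLattice_uniformizer_latt_mul_diagonal hϖ, latt_mul_diagonal_le_iff hϖ]
      constructor <;> omega
    · rw [hA k hk.le, hA (k + 1) hk, latt_mul_diagonal_le_iff hϖ]
      constructor <;> omega
  · -- `A k` modular `(−j, j+1)`, `A (k+1)` self-dual `(−(j+1), j+1)`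
    have hmod : IsModularLattice σ ϖ ((StdForm.antidiagonal 2).over K) (A k).1 := by
      rw [hA k hk.le]; exact (isSpecialLattice_latt_frame_chain hd P hP N hG hk.le).2 (by rw [Nat.not_even_iff_odd]; exact ⟨j, hj⟩)
    have hsd : IsSelfDualLattice σ ((StdForm.antidiagonal 2).over K) (A (k + 1)).1 := by
      rw [hA (k + 1) hk]; exact (isSpecialLattice_latt_frame_chain hd P hP N hG (Nat.succ_le_of_lt hk)).1 ⟨j + 1, by omega⟩
    refine Or.inr ⟨hsd, hmod, ?_, ?_⟩
    · rw [hA k hk.le, hA (k + 1) hk, scaleLattice_uniformizer_latt_mul_diagonal hϖ, latt_mul_diagonal_le_iff hϖ]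
      constructor <;> omega
    · rw [hA k hk.le, hA (k + 1) hk, latt_mul_diagonal_le_iff hϖ]
      constructor <;> omega

/-! ## §2 Every vertex is the end of a framed chain -/

/-- **Normal frames**: every vertex of `X₂` is `latt (P·diag(ϖ^{−⌊N∕2⌋}, ϖ^{⌈N∕2⌉}))` for some `P ∈ GL₂(𝒪)` and `N ∈ ℕ` with `|((σP)ᵀ J₂ P)₀₀| ≤ |ϖ|^N` (★ `exists_frame`, a column
swap to order the exponents, and the frame criteria: `a + b ∈ {0, 1}`, `|ϖ|^{2a − [modular]}|G₀₀| ≤ 1`; `N = b − a`).  By §1, `N = d(x₀, v)`.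
[cite: Serre1980Trees, II.1.1] [cite: Jacobowitz1962, §7–§8] -/
theorem exists_latt_frame_chain (hd : HermitianLattice.UnramifiedLocalConjDatum σ ϖ)
    (v : {M : Submodule 𝒪[K] (Fin 2 → K) // IsSpecialLattice σ ϖ ((StdForm.antidiagonal 2).over K) M}) :
    ∃ P : GL (Fin 2) K, P ∈ glInt 2 K ∧ ∃ N : ℕ, valuation K (formCongr σ P ((StdForm.antidiagonal 2).over K) 0 0) ≤ valuation K ϖ ^ N ∧
      v.1 = latt ((P : Matrix (Fin 2) (Fin 2) K) * Matrix.diagonal ![ϖ ^ (-((N / 2 : ℕ) : ℤ)), ϖ ^ (((N + 1) / 2 : ℕ) : ℤ)]) := by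
  have hσv := valuation_map_eq_of_datum hd
  have hϖ := isUniformizingElement_of_v_eq hd.vϖ
  have hH := isUnimodular₂_antidiagonal_two (K := K)
  haveI := isDiscreteValuationRing_integer_of_compatible hd.vϖ
  have hv0 : valuation K ϖ ≠ 0 := (Valuation.ne_zero_iff _).2 hϖ.ne_zero
  -- a frame with ordered exponents `a ≤ b`
  obtain ⟨P, hP, a, b, hab, hv⟩ : ∃ P : GL (Fin 2) K, P ∈ glInt 2 K ∧ ∃ a b : ℤ, a ≤ b ∧
      v.1 = latt ((P : Matrix (Fin 2) (Fin 2) K) * Matrix.diagonal ![ϖ ^ a, ϖ ^ b]) := by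
    have hg : ∃ g : GL (Fin 2) K, v.1 = latt (g : Matrix (Fin 2) (Fin 2) K) := by
      rcases v.2 with ⟨g, hg, -⟩ | ⟨g, hg, -⟩ <;> exact ⟨g, hg⟩
    obtain ⟨g, hg⟩ := hg
    obtain ⟨P, hP, a, b, hfr⟩ := exists_frame hϖ g
    rcases le_or_gt a b with hab | hba
    · exact ⟨P, hP, a, b, hab, hg.trans hfr⟩
    · -- swap the two columns with `w = antidiag(1,1) ∈ GL₂(𝒪)`
      let w : GL (Fin 2) K := Matrix.GeneralLinearGroup.mkOfDetNeZero !![(0 : K), 1; 1, 0] (by simp [Matrix.det_fin_two_of])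
      have hw : (w : Matrix (Fin 2) (Fin 2) K) = !![(0 : K), 1; 1, 0] := rfl
      have hwI : w ∈ glInt 2 K := mem_glInt_of_coe_eq_antidiag w hw
      refine ⟨P * w, Subgroup.mul_mem _ hP hwI, b, a, hba.le, ?_⟩
      rw [hg, hfr]
      have hmat : (P : Matrix (Fin 2) (Fin 2) K) * Matrix.diagonal ![ϖ ^ a, ϖ ^ b] =
          (((P * w * zpowDiagGL (n := 2) hϖ.ne_zero ![b, a]) * w : GL (Fin 2) K) : Matrix (Fin 2) (Fin 2) K) := by
        rw [Units.val_mul, Units.val_mul, Units.val_mul, coe_zpowDiagGL_two, hw]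
        simp only [Matrix.mul_assoc]
        congr 1
        ext i j
        fin_cases i <;> fin_cases j <;> simp [Matrix.mul_apply, Fin.sum_univ_two]
      rw [hmat, latt_mul_of_mem_glInt _ w hwI, Units.val_mul, coe_zpowDiagGL_two]
  -- the level `N = b − a` and the type
  obtain ⟨N, hN⟩ : ∃ N : ℕ, (N : ℤ) = b - a := ⟨(b - a).toNat, Int.toNat_of_nonneg (by omega)⟩
  have hspec := v.2
  rw [hv] at hspec
  refine ⟨P, hP, N, ?_, ?_⟩
  · -- `|G₀₀| ≤ |ϖ|^N` from the (0,0) entry bound of the frame criterion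
    have h00 : valuation K ϖ ^ (-(N : ℤ)) * valuation K (formCongr σ P ((StdForm.antidiagonal 2).over K) 0 0) ≤ 1 := by
      rcases hspec with hsd | hmod
      · obtain ⟨hab0, hbd⟩ := (isSelfDualLattice_frame_iff σ hσv hϖ hH P hP a b).1 hsd
        have h := hbd 0 0
        simp only [Fin.isValue, Matrix.cons_val_zero] at h
        rwa [show a + a = -(N : ℤ) by omega] at h
      · obtain ⟨hab1, hbd⟩ := (isModularLattice_frame_iff σ hσv hϖ hH P hP a b).1 hmod
        have h := hbd 0 0
        simp only [Fin.isValue, Matrix.cons_val_zero] at h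
        rwa [show a + a - 1 = -(N : ℤ) by omega] at h
    calc valuation K (formCongr σ P ((StdForm.antidiagonal 2).over K) 0 0)
        = valuation K ϖ ^ (N : ℤ) * (valuation K ϖ ^ (-(N : ℤ)) * valuation K (formCongr σ P ((StdForm.antidiagonal 2).over K) 0 0)) := by
          rw [← mul_assoc, ← zpow_add₀ hv0, add_neg_cancel, zpow_zero, one_mul]
      _ ≤ valuation K ϖ ^ (N : ℤ) * 1 := mul_le_mul_right h00 _
      _ = valuation K ϖ ^ N := by rw [mul_one, zpow_natCast]
  · -- the exponents are `(−⌊N∕2⌋, ⌈N∕2⌉)`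
    have hsum : a + b = 0 ∨ a + b = 1 := by
      rcases hspec with hsd | hmod
      · exact Or.inl ((isSelfDualLattice_frame_iff σ hσv hϖ hH P hP a b).1 hsd).1
      · exact Or.inr ((isModularLattice_frame_iff σ hσv hϖ hH P hP a b).1 hmod).1
    have ha : a = -((N / 2 : ℕ) : ℤ) := by omega
    have hb : b = (((N + 1) / 2 : ℕ) : ℤ) := by omega
    rw [hv, ha, hb]

/-! ## §3 Two letters for the consumers: fixed ⟺ mapped into itself; the `(0,0)` Gram entry of a frame -/

/-- **Fixed ⟺ mapped into itself**: for `γ ∈ U₂` and a vertex `v` of `X₂`, `γ·v = v ↔ γ·v.1 ≤ v.1` — a unitary preserves the type, and comparable special lattices of one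
type are equal ((D1) `eq_of_le_of_isSelfDualLattice`, (D2) `eq_of_le_of_isModularLattice`). [cite: Jacobowitz1962, §7–§8] [cite: Kottwitz1986BaseChangeUnits, §3] -/
theorem latticeTreeIso_apply_eq_self_iff_mapGL_le (hd : HermitianLattice.UnramifiedLocalConjDatum σ ϖ)
    (γ : unitaryGroupOfForm σ ((StdForm.antidiagonal 2).over K))
    (v : {M : Submodule 𝒪[K] (Fin 2 → K) // IsSpecialLattice σ ϖ ((StdForm.antidiagonal 2).over K) M}) :
    latticeTreeIso σ ϖ ((StdForm.antidiagonal 2).over K) γ v = v ↔ mapGL (γ : GL (Fin 2) K) v.1 ≤ v.1 := by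
  have hσv := valuation_map_eq_of_datum hd
  rw [latticeTreeIso_apply_eq_self_iff]
  refine ⟨le_of_eq, fun hle => ?_⟩
  rcases v.2 with hsd | hmod
  · exact eq_of_le_of_isSelfDualLattice σ hσv (isSelfDualLattice_mapGL σ _ _ γ.2 hsd) hsd hle
  · exact eq_of_le_of_isModularLattice σ hσv (isModularLattice_mapGL σ ϖ _ _ γ.2 hmod) hmod hle


omit [Valued K (WithZero (Multiplicative ℤ))] [ValuativeRel K] [(Valued.v : Valuation K (WithZero (Multiplicative ℤ))).Compatible] in
/-- The `(0,0)` Gram entry of a frame for `J₂ = antidiag(1,1)`: `((σP)ᵀ J₂ P)₀₀ = σ(x) y + σ(y) x`, `(x, y)` the first column of `P`. [cite: Jacobowitz1962, §4] -/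
theorem formCongr_antidiagonal_two_apply_zero_zero (P : GL (Fin 2) K) :
    formCongr σ P ((StdForm.antidiagonal 2).over K) 0 0 =
      σ ((P : Matrix (Fin 2) (Fin 2) K) 0 0) * (P : Matrix (Fin 2) (Fin 2) K) 1 0 + σ ((P : Matrix (Fin 2) (Fin 2) K) 1 0) * (P : Matrix (Fin 2) (Fin 2) K) 0 0 := by
  rw [formCongr, UnitaryGroup.Two.antidiagonal_two_over_eq]
  simp [Matrix.mul_apply, Fin.sum_univ_two]
  ring

end Two

end Summit.HodgeConjecture.HodgeConjecture.R90.S6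

end
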